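import Summits.MatrixMultiplication.OmegaCensus.ThreeSetTilingPartThreeSix

/-!
# No coset part of size three in a cube law triple when `6·exp(A) + 4 < |A|`; `Dih(ℤ_m × ℤ_l)`, `m ∣ l`, `m ≥ 7` (kernel)

ω-census `pub-omega`, family (b3), seat pub-omega-group gen 35.  Framing: lottery ticket; floor = certified bounds/negative
ranges.  VALUE: the law corollaries of `ThreeSetTilingPartThreeSix.card_le_of_shifted_form_part_three_six` (constant `6`,
from the amortised imbalance bound `54·Δ ≤ 36n + 18`); NOT progress on ω; no census word changes.  They replace the hypothesis
`8e < |A| + 3` of `ThreeSetTilingPartThreeSharp.cube_law_no_coset_part_three_sharp` by `6e + 4 < |A|`.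

* **`cube_law_no_coset_part_three_six`** — `G` dihedral-like over ANY finite abelian `A` (any parity, any `c₀`), every element of
  `A` of order `≤ e` with `6e + 4 < |A|`: a TPP triple of `G` with cube coset parts attaining `3|S||T||U| + 8 = 8|A|` has no coset
  part of size `3`; `…_six_of_exponent` (`6·exp A + 4 < |A|`).
* **`cube_law_no_coset_part_three_zmod_prod`** — the same over `ℤ_m × ℤ_l` with `m ∣ l`, `m ≥ 7` (e.g. `ℤ_7 × ℤ_49`,
  `ℤ_7 × ℤ_112`: the census cells `(3,1,38)`, `(3,2,19)` @ 343 and `(3,1,87)`, `(3,3,29)` @ 784 become KERNEL).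
-/

namespace Summit.MatrixMultiplication.OmegaCensus

open Finset

section Law

open Literature.Combinatorics.Additive

variable {A : Type} [AddCommGroup A] [DecidableEq A] [Fintype A] {G : Type} [Group G] [DecidableEq G]
  {ρ τ : A → G} {c₀ : A} {S T U : Finset G}

/-- The first coset part, constant six. [folklore] -/
theorem cube_law_first_coset_part_ne_three_six
    (hρρ : ∀ a b, ρ a * ρ b = ρ (a + b)) (hρτ : ∀ a b, ρ a * τ b = τ (b - a))
    (hτρ : ∀ a b, τ a * ρ b = τ (a + b)) (hττ : ∀ a b, τ a * τ b = ρ (c₀ + b - a))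
    (hρ : Function.Injective ρ) (hτ : Function.Injective τ) (hne : ∀ a b, ρ a ≠ τ b)
    (hsurj : ∀ g, (∃ a, ρ a = g) ∨ (∃ a, τ a = g))
    (h : TripleProductProperty S T U)
    (hS : (univ.filter fun a : A => ρ a ∈ S).card = (univ.filter fun a : A => τ a ∈ S).card)
    (hT : (univ.filter fun a : A => ρ a ∈ T).card = (univ.filter fun a : A => τ a ∈ T).card)
    (hU : (univ.filter fun a : A => ρ a ∈ U).card = (univ.filter fun a : A => τ a ∈ U).card)
    (hV : 3 * (S.card * T.card * U.card) + 8 = 8 * Fintype.card A)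
    (e : ℕ) (he : ∀ x : A, addOrderOf x ≤ e) (hA : 6 * e + 4 < Fintype.card A) :
    (univ.filter fun a : A => ρ a ∈ S).card ≠ 3 := by
  obtain ⟨W, X, Y, κ₁, κ₂, κ₃, x₀, cW, -, -, -, i₁, i₂, i₃, d₁₂, d₁₃, d₂₃, hcover⟩ :=
    cube_shifted_form_of_law hρρ hρτ hτρ hττ hρ hτ hne hsurj h hS hT hU hV
  rw [← cW]
  exact shifted_form_card_ne_three_six i₁ i₂ i₃ d₁₂ d₁₃ d₂₃ hcover e he hA

/-- **No coset part of size three, constant six** (kernel).  `G` dihedral-like over ANY finite abelian `A` (any parity, any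
`c₀`); every element of `A` of order `≤ e` with `6e + 4 < |A|`.  Then a TPP triple with cube coset parts attaining
`3|S||T||U| + 8 = 8|A|` has `|S₀|, |T₀|, |U₀| ≠ 3`. [folklore] -/
theorem cube_law_no_coset_part_three_six
    (hρρ : ∀ a b, ρ a * ρ b = ρ (a + b)) (hρτ : ∀ a b, ρ a * τ b = τ (b - a))
    (hτρ : ∀ a b, τ a * ρ b = τ (a + b)) (hττ : ∀ a b, τ a * τ b = ρ (c₀ + b - a))
    (hρ : Function.Injective ρ) (hτ : Function.Injective τ) (hne : ∀ a b, ρ a ≠ τ b)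
    (hsurj : ∀ g, (∃ a, ρ a = g) ∨ (∃ a, τ a = g))
    (h : TripleProductProperty S T U)
    (hS : (univ.filter fun a : A => ρ a ∈ S).card = (univ.filter fun a : A => τ a ∈ S).card)
    (hT : (univ.filter fun a : A => ρ a ∈ T).card = (univ.filter fun a : A => τ a ∈ T).card)
    (hU : (univ.filter fun a : A => ρ a ∈ U).card = (univ.filter fun a : A => τ a ∈ U).card)
    (hV : 3 * (S.card * T.card * U.card) + 8 = 8 * Fintype.card A)
    (e : ℕ) (he : ∀ x : A, addOrderOf x ≤ e) (hA : 6 * e + 4 < Fintype.card A) :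
    (univ.filter fun a : A => ρ a ∈ S).card ≠ 3 ∧ (univ.filter fun a : A => ρ a ∈ T).card ≠ 3 ∧
      (univ.filter fun a : A => ρ a ∈ U).card ≠ 3 := by
  have hV' : 3 * (T.card * U.card * S.card) + 8 = 8 * Fintype.card A := by rw [← hV]; ring
  have hV'' : 3 * (U.card * S.card * T.card) + 8 = 8 * Fintype.card A := by rw [← hV]; ring
  exact ⟨cube_law_first_coset_part_ne_three_six hρρ hρτ hτρ hττ hρ hτ hne hsurj h hS hT hU hV e he hA,
    cube_law_first_coset_part_ne_three_six hρρ hρτ hτρ hττ hρ hτ hne hsurj h.rotate hT hU hS hV' e he hA,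
    cube_law_first_coset_part_ne_three_six hρρ hρτ hτρ hττ hρ hτ hne hsurj h.rotate.rotate hU hS hT hV'' e he hA⟩

/-- **Exponent form** (constant six): `6·exp(A) + 4 < |A|` ⇒ no coset part of size `3`. [folklore] -/
theorem cube_law_no_coset_part_three_six_of_exponent
    (hρρ : ∀ a b, ρ a * ρ b = ρ (a + b)) (hρτ : ∀ a b, ρ a * τ b = τ (b - a))
    (hτρ : ∀ a b, τ a * ρ b = τ (a + b)) (hττ : ∀ a b, τ a * τ b = ρ (c₀ + b - a))
    (hρ : Function.Injective ρ) (hτ : Function.Injective τ) (hne : ∀ a b, ρ a ≠ τ b)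
    (hsurj : ∀ g, (∃ a, ρ a = g) ∨ (∃ a, τ a = g))
    (h : TripleProductProperty S T U)
    (hS : (univ.filter fun a : A => ρ a ∈ S).card = (univ.filter fun a : A => τ a ∈ S).card)
    (hT : (univ.filter fun a : A => ρ a ∈ T).card = (univ.filter fun a : A => τ a ∈ T).card)
    (hU : (univ.filter fun a : A => ρ a ∈ U).card = (univ.filter fun a : A => τ a ∈ U).card)
    (hV : 3 * (S.card * T.card * U.card) + 8 = 8 * Fintype.card A)
    (hA : 6 * AddMonoid.exponent A + 4 < Fintype.card A) :
    (univ.filter fun a : A => ρ a ∈ S).card ≠ 3 ∧ (univ.filter fun a : A => ρ a ∈ T).card ≠ 3 ∧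
      (univ.filter fun a : A => ρ a ∈ U).card ≠ 3 :=
  cube_law_no_coset_part_three_six hρρ hρτ hτρ hττ hρ hτ hne hsurj h hS hT hU hV (AddMonoid.exponent A)
    (fun x => AddMonoid.addOrderOf_le_exponent AddMonoid.ExponentExists.of_finite x) hA

end Law

section ProductLaw

open Literature.Combinatorics.Additive

variable {m l : ℕ} [NeZero m] [NeZero l] {G : Type} [Group G] [DecidableEq G] {ρ τ : ZMod m × ZMod l → G}
  {c₀ : ZMod m × ZMod l} {S T U : Finset G}

/-- **No coset part of size three in a cube law triple over `Dih(ℤ_m × ℤ_l)`, `m ∣ l`, `m ≥ 7`** (kernel; any parity, any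
presentation constant `c₀`; e.g. `ℤ_7 × ℤ_49`, `ℤ_7 × ℤ_112`). [folklore] -/
theorem cube_law_no_coset_part_three_zmod_prod (hml : m ∣ l) (hm : 7 ≤ m)
    (hρρ : ∀ a b, ρ a * ρ b = ρ (a + b)) (hρτ : ∀ a b, ρ a * τ b = τ (b - a))
    (hτρ : ∀ a b, τ a * ρ b = τ (a + b)) (hττ : ∀ a b, τ a * τ b = ρ (c₀ + b - a))
    (hρ : Function.Injective ρ) (hτ : Function.Injective τ) (hne : ∀ a b, ρ a ≠ τ b)
    (hsurj : ∀ g, (∃ a, ρ a = g) ∨ (∃ a, τ a = g))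
    (h : TripleProductProperty S T U)
    (hS : (univ.filter fun a : ZMod m × ZMod l => ρ a ∈ S).card =
      (univ.filter fun a : ZMod m × ZMod l => τ a ∈ S).card)
    (hT : (univ.filter fun a : ZMod m × ZMod l => ρ a ∈ T).card =
      (univ.filter fun a : ZMod m × ZMod l => τ a ∈ T).card)
    (hU : (univ.filter fun a : ZMod m × ZMod l => ρ a ∈ U).card =
      (univ.filter fun a : ZMod m × ZMod l => τ a ∈ U).card)
    (hV : 3 * (S.card * T.card * U.card) + 8 = 8 * Fintype.card (ZMod m × ZMod l)) :
    (univ.filter fun a : ZMod m × ZMod l => ρ a ∈ S).card ≠ 3 ∧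
      (univ.filter fun a : ZMod m × ZMod l => ρ a ∈ T).card ≠ 3 ∧
      (univ.filter fun a : ZMod m × ZMod l => ρ a ∈ U).card ≠ 3 := by
  have hcard : Fintype.card (ZMod m × ZMod l) = m * l := by rw [Fintype.card_prod, ZMod.card, ZMod.card]
  have hl : 7 ≤ l := le_trans hm (Nat.le_of_dvd (Nat.pos_of_ne_zero (NeZero.ne l)) hml)
  exact cube_law_no_coset_part_three_six hρρ hρτ hτρ hττ hρ hτ hne hsurj h hS hT hU hV l
    (addOrderOf_le_of_zmod_prod hml) (by rw [hcard]; nlinarith)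

end ProductLaw

end Summit.MatrixMultiplication.OmegaCensus
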